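import Literature.InformationTheory.Entanglement.GHZMermin
import HarnessLib

/-!
# The `n`-party Mermin–Klyshko (Bell–MK, MABK) inequality `|⟨𝓑_n⟩|_LHV ≤ 1`

Topic `Literature/InformationTheory/Entanglement`, the `n`-party member of the family
`CHSHInequality.lean` (`n = 2`, `LHV.chsh_pointwise`, `LHV.chsh_inequality`) and `GHZMermin.lean`
(`n = 3`, `GHZ.mermin_pointwise`, `GHZ.mermin_inequality`).  Sources (held texts, read at the
cited places):

* S. Kanno, J. Soda, *Infinite violation of Bell inequalities in inflation*, Phys. Rev. D 96,
  083501 (2017) = arXiv:1705.06199 [KannoSoda2017], §2.2 “Mermin-Klyshko inequalities”, eq.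
  (2.6): “Defining `𝓑₁ = 𝒪₁` and `𝓑′₁ = 𝒪′₁`, the Mermin-Klyshko operator is defined recursively as
  `𝓑_n = ½ 𝓑_{n−1}(𝒪_n + 𝒪′_n) + ½ 𝓑′_{n−1}(𝒪_n − 𝒪′_n)`, `n = 2, 3, 4, ⋯` where `𝓑′_{n−1}` is
  obtained from `𝓑_{n−1}` by interchanging primed and nonprimed operators”; eq. (2.8): “In local
  classical hidden variable theories, the Mermin-Klyshko inequalities reads **`|⟨𝓑_n⟩| ≤ 1`,
  `n = 1, 2, 3, ⋯`**, because we can have `𝒪_n = 𝒪′_n` or `𝒪_n = −𝒪′_n`”; eq. (2.9) (quantum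
  bound `2^{(n−1)/2}`, not formalised here).
* A. Cabello, *Bell's inequality for `n` spin-`s` particles*, Phys. Rev. A 65, 062105 (2002) =
  arXiv:quant-ph/0202126 [Cabello2002nSpinS], §II: the unnormalised recursion
  “`M_n = M_{n−1}(A_n + B_n) + K_{n−1}(A_n − B_n)`, letting `M₁ = A₁`, and `K_n` being the same as
  `M_n` but exchanging the A's for B's. In particular, `M₂ = A₁A₂ + A₁B₂ + B₁A₂ − B₁B₂` …”;
  “In any theory in which local variables of particle `j` determine the results of local
  observables `A_j` and `B_j`, the absolute value of `M_n` is bound as follows: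
  `|M_n| ≤ 2^{n−1} s^n` (6) … If `A_j` and `B_j` are observables taking values −1 or 1 … we
  obtain the Mermin-Klyshko inequality [Belinskii–Klyshko 1993] … If `n = 2` we obtain the CHSH
  inequality”; proof: “observables `A_j` and `B_j` have predefined values `a_j` and `b_j` …
  Since `M_n` is linear in each local observable … `M_n` will take its extremal values when local
  observables take their extremal values … The various combinations of `a_j = ±s` and `b_j = ±s`
  always give `±2^{n−1}sⁿ`, Q.E.D.”  (Here `M_n = 2^{n−1}𝓑_n` for `s = 1`.)
* D. Alsina, J. I. Latorre, Phys. Rev. A 94, 012314 (2016) = arXiv:1605.04220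
  [AlsinaLatorre2016], §II: the Mermin polynomials actually measured on the IBM five-qubit device,
  printed in full — `M₃ = (a₁a₂a′₃ + a₁a′₂a₃ + a′₁a₂a₃) − a′₁a′₂a′₃` with “`⟨M₃⟩^{LR} ≤ 2`”, the
  16-term `M₄` with “a classical bound of `⟨M₄⟩^{LR} ≤ 4`”, and the 16-term `M₅` with “a
  classical bound of `⟨M₅⟩^{LR} ≤ 4`” (quantum bounds `4`, `8√2`, `16`).

HONEST FRAMING (pub-qadeq lane — multi-qubit ‘Mermin-inequality violation’ device demonstrations
such as [AlsinaLatorre2016] and the `N`-qubit GHZ milestones read against the LOCAL bound):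
instance-level adjudication of specific advantage claims; no claim about BQP vs BPP or the
summit.  This file makes the local-realistic bound a tree theorem for every `n`; nothing here
concerns devices, loopholes or statistics.

## Contents (all proved, 0 named facts)

* **`mkVal n a b`** — the Mermin–Klyshko polynomial `𝓑_n` of [KannoSoda2017] eq. (2.6)
  evaluated at hidden-variable values `a b : Fin n → ℝ` (unprimed / primed settings), defined by
  the printed recursion with `𝓑′_n(a, b) = 𝓑_n(b, a)` and the convenient base `𝓑₀ = 1` (so that
  `𝓑₁ = a₀`, `mkVal_one`); `mkVal_two` (`𝓑₂ = ½·CHSH`), `mkVal_three`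
  (`𝓑₃ = ½(a₀a₁b₂ + a₀b₁a₂ + b₀a₁a₂ − b₀b₁b₂)`).
* Bridges to the printed polynomials: **`two_mul_mkVal_two_eq_chsh`** (Cabello's `M₂` = the CHSH
  combination of `LHV.chsh_pointwise`), **`two_mul_mkVal_three_eq_mermin`** (Alsina–Latorre's
  `M₃` = the combination of `GHZ.mermin_pointwise`, `= 2𝓑₃`), **`alsinaLatorre_M4_eq`**
  (`M₄ = 4𝓑₄`, all 16 printed terms) and **`alsinaLatorre_M5_eq`** (`M₅ = 4𝓑₅`, all 16 printed
  terms).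
* **`abs_mkVal_le_one`** — the pointwise local-realistic bound: `|a_i|, |b_i| ≤ 1 ⟹ |𝓑_n| ≤ 1`
  (induction on the recursion: `|x + y| + |x − y| ≤ 2`); Cabello's form
  **`abs_cabelloM_le`** (`|M_n| ≤ 2^{n−1}` for `M_n := 2^{n−1}𝓑_n`); the printed bounds
  **`alsinaLatorre_M3_le`** (`≤ 2`), **`alsinaLatorre_M4_le`** (`≤ 4`), **`alsinaLatorre_M5_le`**
  (`≤ 4`); tightness **`mkVal_vertex`** (at `a_i, b_i ∈ {±1}` the value is `±1` — “the various
  combinations … always give `±2^{n−1}sⁿ`”).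
* The correlator form: **`mkCoeff n s`** (the coefficient of the correlator with setting word
  `s : Fin n → Bool`, `false` = unprimed), **`mkVal_eq_sum`**
  (`𝓑_n(a,b) = Σ_s c_n(s) Π_i (s_i ? b_i : a_i)`), and for LHV models — a probability space
  `(Λ, μ)`, `[−1,1]`-valued a.e.-strongly-measurable responses `X i t : Λ → ℝ` for party `i` and
  setting `t`, correlators `E(s) = ∫ Π_i X_i^{s_i} dμ` — **`mermin_klyshko_inequality`**:
  `|Σ_s c_n(s) E(s)| ≤ 1` ([KannoSoda2017] eq. (2.8)), with the unnormalised
  **`mermin_klyshko_inequality_cabello`** (`|Σ_s 2^{n−1}c_n(s) E(s)| ≤ 2^{n−1}`, [Cabello2002nSpinS]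
  eq. (6) at `s = 1`) and the integral-of-polynomial form **`abs_integral_mkVal_le_one`**.

NOT formalised: the quantum bound `|⟨𝓑_n⟩| ≤ 2^{(n−1)/2}` (2.9) and its saturation by `|GHZ_n⟩`,
Mermin's and Ardehali's original (odd/even) normalisations beyond the printed `n ≤ 5` bridges,
the spin-`s` generalisation of [Cabello2002nSpinS], Svetlichny's inequality.

## Mathlib / tree search

Mathlib: `Mathlib.Algebra.Star.CHSH` (two parties, operator form) only.  Tree: `LHV.chsh_pointwise`
/ `LHV.chsh_inequality` (`n = 2`) and `GHZ.mermin_pointwise` / `GHZ.mermin_inequality` (`n = 3`)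
are recovered as the cases `n = 2, 3` (bridging lemmas above); `LHV.abs_mul_le_one`,
`LHV.integrable_mul_of_abs_le_one` conventions reused.  The recursion on `Fin (n+1)`-tuples uses
Mathlib's `Fin.init` / `Fin.snoc` / `Fin.snocEquiv` and `Fin.prod_univ_castSucc`.
-/

namespace Literature.InformationTheory.Entanglement

namespace MerminKlyshko

open MeasureTheory Finset

variable {n : ℕ}

/-! ## The Mermin–Klyshko polynomial, pointwise -/

/-- The Mermin–Klyshko polynomial `𝓑_n` evaluated at hidden-variable values: `a i` is the value
of the unprimed observable `𝒪_i`, `b i` that of the primed one `𝒪′_i`;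
`𝓑_{n+1}(a,b) = ½ 𝓑_n(a,b)(a_n + b_n) + ½ 𝓑_n(b,a)(a_n − b_n)` (the second term is `𝓑′_n`, “obtained
from `𝓑_n` by interchanging primed and nonprimed”), with base `𝓑₀ = 1` so that `𝓑₁ = a₀ = 𝒪₁`.
[cite: KannoSoda2017, §2.2 eq. (2.6)] -/
noncomputable def mkVal : (n : ℕ) → (Fin n → ℝ) → (Fin n → ℝ) → ℝ
  | 0, _, _ => 1
  | n + 1, a, b =>
      1 / 2 * mkVal n (Fin.init a) (Fin.init b) * (a (Fin.last n) + b (Fin.last n)) +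
        1 / 2 * mkVal n (Fin.init b) (Fin.init a) * (a (Fin.last n) - b (Fin.last n))

/-- Base of the recursion (our convention `𝓑₀ = 1`). [cite: KannoSoda2017, §2.2 eq. (2.6)] -/
@[simp] theorem mkVal_zero (a b : Fin 0 → ℝ) : mkVal 0 a b = 1 := rfl

/-- The printed recursion (2.6). [cite: KannoSoda2017, §2.2 eq. (2.6)] -/
theorem mkVal_succ (a b : Fin (n + 1) → ℝ) :
    mkVal (n + 1) a b =
      1 / 2 * mkVal n (Fin.init a) (Fin.init b) * (a (Fin.last n) + b (Fin.last n)) +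
        1 / 2 * mkVal n (Fin.init b) (Fin.init a) * (a (Fin.last n) - b (Fin.last n)) := rfl

/-- The recursion on `snoc`-extended tuples. [cite: KannoSoda2017, §2.2 eq. (2.6)] -/
theorem mkVal_snoc (a b : Fin n → ℝ) (x y : ℝ) :
    mkVal (n + 1) (Fin.snoc a x) (Fin.snoc b y) =
      1 / 2 * mkVal n a b * (x + y) + 1 / 2 * mkVal n b a * (x - y) := by
  rw [mkVal_succ, Fin.init_snoc, Fin.init_snoc, Fin.snoc_last, Fin.snoc_last]

/-- `𝓑₁ = 𝒪₁`. [cite: KannoSoda2017, §2.2 (“Defining 𝓑₁ = 𝒪₁ and 𝓑′₁ = 𝒪′₁”)] -/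
theorem mkVal_one (a b : Fin 1 → ℝ) : mkVal 1 a b = a 0 := by
  rw [mkVal_succ, mkVal_zero, mkVal_zero, Fin.last_zero]
  ring

/-- `𝓑₂ = ½(a₀a₁ + a₀b₁ + b₀a₁ − b₀b₁)` — eq. (2.7), half the CHSH combination.
[cite: KannoSoda2017, §2.2 eq. (2.7)] -/
theorem mkVal_two (a b : Fin 2 → ℝ) :
    mkVal 2 a b = 1 / 2 * (a 0 * a 1 + a 0 * b 1 + b 0 * a 1 - b 0 * b 1) := by
  rw [mkVal_succ, mkVal_one, mkVal_one]
  simp only [Fin.init, Fin.castSucc_zero, Fin.last]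
  have h1 : (⟨1, by norm_num⟩ : Fin 2) = 1 := rfl
  rw [h1]
  ring

/-- `𝓑₃ = ½(a₀a₁b₂ + a₀b₁a₂ + b₀a₁a₂ − b₀b₁b₂)`. [cite: KannoSoda2017, §2.2 eq. (2.7);
Cabello2002nSpinS, §II eq. (5)] -/
theorem mkVal_three (a b : Fin 3 → ℝ) :
    mkVal 3 a b =
      1 / 2 * (a 0 * a 1 * b 2 + a 0 * b 1 * a 2 + b 0 * a 1 * a 2 - b 0 * b 1 * b 2) := by
  rw [mkVal_succ, mkVal_two, mkVal_two]
  simp only [Fin.init, Fin.last, Fin.castSucc_zero]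
  have h1 : (Fin.castSucc (1 : Fin 2) : Fin 3) = 1 := rfl
  have h2 : (⟨2, by norm_num⟩ : Fin 3) = 2 := rfl
  rw [h1, h2]
  ring

/-! ## Bridges to the printed polynomials (`n = 2, 3, 4, 5`) -/

/-- Cabello's `M₂ = A₁A₂ + A₁B₂ + B₁A₂ − B₁B₂` (“If n = 2 we obtain the CHSH inequality”) is
`2𝓑₂`; pointwise this is the combination `x y + x y′ + x′ y − x′ y′` of `LHV.chsh_pointwise`
(`a = (x, y)`, `b = (x′, y′)`). [cite: Cabello2002nSpinS, §II eq. (4)] -/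
theorem two_mul_mkVal_two_eq_chsh (x x' y y' : ℝ) :
    2 * mkVal 2 ![x, y] ![x', y'] = x * y + x * y' + x' * y - x' * y' := by
  rw [mkVal_two]
  simp only [Matrix.cons_val_zero, Matrix.cons_val_one]
  ring

/-- Alsina–Latorre's `M₃ = (a₁a₂a′₃ + a₁a′₂a₃ + a′₁a₂a₃) − a′₁a′₂a′₃` is `2𝓑₃` (unprimed `a`,
primed `b`). [cite: AlsinaLatorre2016, §II eq. (1)] -/
theorem alsinaLatorre_M3_eq (a b : Fin 3 → ℝ) :
    a 0 * a 1 * b 2 + a 0 * b 1 * a 2 + b 0 * a 1 * a 2 - b 0 * b 1 * b 2 = 2 * mkVal 3 a b := by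
  rw [mkVal_three]; ring

/-- The combination of `GHZ.mermin_pointwise`, `x₁y₂y₃ + y₁x₂y₃ + y₁y₂x₃ − x₁x₂x₃` (`x_i = v(X_i)`,
`y_i = v(Y_i)`; Alsina–Latorre's `a_i = Y_i`, `a′_i = X_i`), is `2𝓑₃(y, x)`.
[cite: AlsinaLatorre2016, §II eq. (1)] -/
theorem two_mul_mkVal_three_eq_mermin (x₁ x₂ x₃ y₁ y₂ y₃ : ℝ) :
    2 * mkVal 3 ![y₁, y₂, y₃] ![x₁, x₂, x₃] =
      x₁ * y₂ * y₃ + y₁ * x₂ * y₃ + y₁ * y₂ * x₃ - x₁ * x₂ * x₃ := by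
  rw [mkVal_three]
  simp
  ring

/-- `𝓑₄` unfolded one step. [cite: KannoSoda2017, §2.2 eq. (2.6)] -/
private theorem mkVal_four (a b : Fin 4 → ℝ) :
    mkVal 4 a b =
      1 / 2 * (1 / 2 * (a 0 * a 1 * b 2 + a 0 * b 1 * a 2 + b 0 * a 1 * a 2 - b 0 * b 1 * b 2))
          * (a 3 + b 3) +
        1 / 2 * (1 / 2 * (b 0 * b 1 * a 2 + b 0 * a 1 * b 2 + a 0 * b 1 * b 2 - a 0 * a 1 * a 2))
          * (a 3 - b 3) := by
  rw [mkVal_succ, mkVal_three, mkVal_three]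
  simp only [Fin.init, Fin.last, Fin.castSucc_zero]
  have h1 : (Fin.castSucc (1 : Fin 3) : Fin 4) = 1 := rfl
  have h2 : (Fin.castSucc (2 : Fin 3) : Fin 4) = 2 := rfl
  have h3 : (⟨3, by norm_num⟩ : Fin 4) = 3 := rfl
  rw [h1, h2, h3]

/-- **Alsina–Latorre's `M₄` is `4𝓑₄`** — the printed 16-term polynomial
`M₄ = −(a₁a₂a₃a₄) + (a₁a₂a₃a′₄ + a₁a₂a′₃a₄ + a₁a′₂a₃a₄ + a′₁a₂a₃a₄) + (a₁a₂a′₃a′₄ + a₁a′₂a₃a′₄ +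
a₁a′₂a′₃a₄ + a′₁a₂a₃a′₄ + a′₁a₂a′₃a₄ + a′₁a′₂a₃a₄) − (a₁a′₂a′₃a′₄ + a′₁a₂a′₃a′₄ + a′₁a′₂a₃a′₄ +
a′₁a′₂a′₃a₄) − (a′₁a′₂a′₃a′₄)` (unprimed `a`, primed `b`, indices shifted to `0…3`).
[cite: AlsinaLatorre2016, §II eq. (2)] -/
theorem alsinaLatorre_M4_eq (a b : Fin 4 → ℝ) :
    -(a 0 * a 1 * a 2 * a 3)
      + (a 0 * a 1 * a 2 * b 3 + a 0 * a 1 * b 2 * a 3 + a 0 * b 1 * a 2 * a 3 + b 0 * a 1 * a 2 * a 3)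
      + (a 0 * a 1 * b 2 * b 3 + a 0 * b 1 * a 2 * b 3 + a 0 * b 1 * b 2 * a 3
          + b 0 * a 1 * a 2 * b 3 + b 0 * a 1 * b 2 * a 3 + b 0 * b 1 * a 2 * a 3)
      - (a 0 * b 1 * b 2 * b 3 + b 0 * a 1 * b 2 * b 3 + b 0 * b 1 * a 2 * b 3 + b 0 * b 1 * b 2 * a 3)
      - b 0 * b 1 * b 2 * b 3 = 4 * mkVal 4 a b := by
  rw [mkVal_four]; ring

/-- `𝓑₅` unfolded one step. [cite: KannoSoda2017, §2.2 eq. (2.6)] -/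
private theorem mkVal_five (a b : Fin 5 → ℝ) :
    mkVal 5 a b =
      1 / 2 * mkVal 4 ![a 0, a 1, a 2, a 3] ![b 0, b 1, b 2, b 3] * (a 4 + b 4) +
        1 / 2 * mkVal 4 ![b 0, b 1, b 2, b 3] ![a 0, a 1, a 2, a 3] * (a 4 - b 4) := by
  rw [mkVal_succ]
  have ha : Fin.init a = ![a 0, a 1, a 2, a 3] := by
    ext i; fin_cases i <;> rfl
  have hb : Fin.init b = ![b 0, b 1, b 2, b 3] := by
    ext i; fin_cases i <;> rfl
  have h4 : (Fin.last 4 : Fin 5) = 4 := rfl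
  rw [ha, hb, h4]

/-- **Alsina–Latorre's `M₅` is `4𝓑₅`** — the printed 16-term polynomial
`M₅ = −(a₁a₂a₃a₄a₅) + (a₁a₂a₃a′₄a′₅ + a₁a₂a′₃a₄a′₅ + a₁a′₂a₃a₄a′₅ + a′₁a₂a₃a₄a′₅ + a₁a₂a′₃a′₄a₅ +
a₁a′₂a₃a′₄a₅ + a′₁a₂a₃a′₄a₅ + a₁a′₂a′₃a₄a₅ + a′₁a₂a′₃a₄a₅ + a′₁a′₂a₃a₄a₅) − (a₁a′₂a′₃a′₄a′₅ +
a′₁a₂a′₃a′₄a′₅ + a′₁a′₂a₃a′₄a′₅ + a′₁a′₂a′₃a₄a′₅ + a′₁a′₂a′₃a′₄a₅)` (unprimed `a`, primed `b`,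
indices shifted to `0…4`). [cite: AlsinaLatorre2016, §II eq. (3)] -/
theorem alsinaLatorre_M5_eq (a b : Fin 5 → ℝ) :
    -(a 0 * a 1 * a 2 * a 3 * a 4)
      + (a 0 * a 1 * a 2 * b 3 * b 4 + a 0 * a 1 * b 2 * a 3 * b 4 + a 0 * b 1 * a 2 * a 3 * b 4
          + b 0 * a 1 * a 2 * a 3 * b 4 + a 0 * a 1 * b 2 * b 3 * a 4 + a 0 * b 1 * a 2 * b 3 * a 4
          + b 0 * a 1 * a 2 * b 3 * a 4 + a 0 * b 1 * b 2 * a 3 * a 4 + b 0 * a 1 * b 2 * a 3 * a 4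
          + b 0 * b 1 * a 2 * a 3 * a 4)
      - (a 0 * b 1 * b 2 * b 3 * b 4 + b 0 * a 1 * b 2 * b 3 * b 4 + b 0 * b 1 * a 2 * b 3 * b 4
          + b 0 * b 1 * b 2 * a 3 * b 4 + b 0 * b 1 * b 2 * b 3 * a 4) = 4 * mkVal 5 a b := by
  rw [mkVal_five, mkVal_four, mkVal_four]
  simp
  ring

/-! ## The local-realistic bound `|𝓑_n| ≤ 1` -/

/-- `|x + y| + |x − y| ≤ 2` for `x, y ∈ [−1, 1]` (“we can have `𝒪_n = 𝒪′_n` or `𝒪_n = −𝒪′_n`”).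
[folklore] -/
private theorem abs_add_add_abs_sub_le_two {x y : ℝ} (hx : |x| ≤ 1) (hy : |y| ≤ 1) :
    |x + y| + |x - y| ≤ 2 := by
  obtain ⟨hx1, hx2⟩ := abs_le.mp hx
  obtain ⟨hy1, hy2⟩ := abs_le.mp hy
  rcases abs_cases (x + y) with ⟨h1, _⟩ | ⟨h1, _⟩ <;> rcases abs_cases (x - y) with ⟨h2, _⟩ | ⟨h2, _⟩ <;>
    rw [h1, h2] <;> linarith

/-- **The Mermin–Klyshko inequality, pointwise (deterministic local values).**  If every
predefined value lies in `[−1, 1]` then `|𝓑_n(a, b)| ≤ 1`, for every `n`.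
[cite: KannoSoda2017, §2.2 eq. (2.8); Cabello2002nSpinS, §II eq. (6) and its proof] -/
theorem abs_mkVal_le_one : ∀ {n : ℕ} (a b : Fin n → ℝ), (∀ i, |a i| ≤ 1) → (∀ i, |b i| ≤ 1) →
    |mkVal n a b| ≤ 1
  | 0, _, _, _, _ => by simp
  | n + 1, a, b, ha, hb => by
    have iha : |mkVal n (Fin.init a) (Fin.init b)| ≤ 1 :=
      abs_mkVal_le_one _ _ (fun i => ha _) (fun i => hb _)
    have ihb : |mkVal n (Fin.init b) (Fin.init a)| ≤ 1 :=
      abs_mkVal_le_one _ _ (fun i => hb _) (fun i => ha _)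
    have hsum := abs_add_add_abs_sub_le_two (ha (Fin.last n)) (hb (Fin.last n))
    rw [mkVal_succ]
    calc |1 / 2 * mkVal n (Fin.init a) (Fin.init b) * (a (Fin.last n) + b (Fin.last n)) +
          1 / 2 * mkVal n (Fin.init b) (Fin.init a) * (a (Fin.last n) - b (Fin.last n))|
        ≤ |1 / 2 * mkVal n (Fin.init a) (Fin.init b) * (a (Fin.last n) + b (Fin.last n))| +
          |1 / 2 * mkVal n (Fin.init b) (Fin.init a) * (a (Fin.last n) - b (Fin.last n))| :=
          abs_add_le _ _
      _ = 1 / 2 * (|mkVal n (Fin.init a) (Fin.init b)| * |a (Fin.last n) + b (Fin.last n)|) +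
          1 / 2 * (|mkVal n (Fin.init b) (Fin.init a)| * |a (Fin.last n) - b (Fin.last n)|) := by
          rw [abs_mul, abs_mul, abs_mul, abs_mul, abs_of_pos (by norm_num : (0:ℝ) < 1 / 2)]
          ring
      _ ≤ 1 / 2 * (1 * |a (Fin.last n) + b (Fin.last n)|) +
          1 / 2 * (1 * |a (Fin.last n) - b (Fin.last n)|) := by
          gcongr
      _ ≤ 1 := by linarith

/-- Cabello's unnormalised polynomial `M_n = 2^{n−1}𝓑_n` (values `±1`, i.e. `s = 1`):
`M_n = M_{n−1}(A_n + B_n) + K_{n−1}(A_n − B_n)`, `M₁ = A₁`. [cite: Cabello2002nSpinS, §II eqs.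
(3)–(5)] -/
noncomputable def cabelloM (n : ℕ) (a b : Fin n → ℝ) : ℝ := 2 ^ (n - 1) * mkVal n a b

/-- Cabello's recursion holds for `M_n = 2^{n−1}𝓑_n` from `n = 1` on:
`M_{n+2} = M_{n+1}(a,b)(x + y) + M_{n+1}(b,a)(x − y)`. [cite: Cabello2002nSpinS, §II eq. (3)] -/
theorem cabelloM_snoc (a b : Fin (n + 1) → ℝ) (x y : ℝ) :
    cabelloM (n + 2) (Fin.snoc a x) (Fin.snoc b y) =
      cabelloM (n + 1) a b * (x + y) + cabelloM (n + 1) b a * (x - y) := by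
  simp only [cabelloM, mkVal_snoc]
  rw [show n + 2 - 1 = n + 1 from rfl, show n + 1 - 1 = n from rfl, pow_succ]
  ring

/-- `M₁ = A₁`. [cite: Cabello2002nSpinS, §II (“letting M₁ = A₁”)] -/
theorem cabelloM_one (a b : Fin 1 → ℝ) : cabelloM 1 a b = a 0 := by
  simp [cabelloM, mkVal_one]

/-- **Cabello's form of the MK inequality** (`s = 1`): `|M_n| ≤ 2^{n−1}` for predefined values in
`[−1, 1]`. [cite: Cabello2002nSpinS, §II eq. (6)] -/
theorem abs_cabelloM_le {n : ℕ} (a b : Fin n → ℝ) (ha : ∀ i, |a i| ≤ 1) (hb : ∀ i, |b i| ≤ 1) :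
    |cabelloM n a b| ≤ 2 ^ (n - 1) := by
  rw [cabelloM, abs_mul, abs_of_pos (by positivity : (0:ℝ) < 2 ^ (n - 1))]
  calc (2:ℝ) ^ (n - 1) * |mkVal n a b| ≤ 2 ^ (n - 1) * 1 := by
        gcongr; exact abs_mkVal_le_one a b ha hb
    _ = 2 ^ (n - 1) := mul_one _

/-- The printed bound `⟨M₃⟩^{LR} ≤ 2`, pointwise. [cite: AlsinaLatorre2016, §II (after eq. (1))] -/
theorem alsinaLatorre_M3_le (a b : Fin 3 → ℝ) (ha : ∀ i, |a i| ≤ 1) (hb : ∀ i, |b i| ≤ 1) :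
    a 0 * a 1 * b 2 + a 0 * b 1 * a 2 + b 0 * a 1 * a 2 - b 0 * b 1 * b 2 ≤ 2 := by
  rw [alsinaLatorre_M3_eq]
  have := (abs_le.mp (abs_mkVal_le_one a b ha hb)).2
  linarith

/-- The printed bound `⟨M₄⟩^{LR} ≤ 4`, pointwise. [cite: AlsinaLatorre2016, §II (after eq. (2))] -/
theorem alsinaLatorre_M4_le (a b : Fin 4 → ℝ) (ha : ∀ i, |a i| ≤ 1) (hb : ∀ i, |b i| ≤ 1) :
    -(a 0 * a 1 * a 2 * a 3)
      + (a 0 * a 1 * a 2 * b 3 + a 0 * a 1 * b 2 * a 3 + a 0 * b 1 * a 2 * a 3 + b 0 * a 1 * a 2 * a 3)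
      + (a 0 * a 1 * b 2 * b 3 + a 0 * b 1 * a 2 * b 3 + a 0 * b 1 * b 2 * a 3
          + b 0 * a 1 * a 2 * b 3 + b 0 * a 1 * b 2 * a 3 + b 0 * b 1 * a 2 * a 3)
      - (a 0 * b 1 * b 2 * b 3 + b 0 * a 1 * b 2 * b 3 + b 0 * b 1 * a 2 * b 3 + b 0 * b 1 * b 2 * a 3)
      - b 0 * b 1 * b 2 * b 3 ≤ 4 := by
  rw [alsinaLatorre_M4_eq]
  have := (abs_le.mp (abs_mkVal_le_one a b ha hb)).2
  linarith

/-- The printed bound `⟨M₅⟩^{LR} ≤ 4`, pointwise. [cite: AlsinaLatorre2016, §II (after eq. (3))] -/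
theorem alsinaLatorre_M5_le (a b : Fin 5 → ℝ) (ha : ∀ i, |a i| ≤ 1) (hb : ∀ i, |b i| ≤ 1) :
    -(a 0 * a 1 * a 2 * a 3 * a 4)
      + (a 0 * a 1 * a 2 * b 3 * b 4 + a 0 * a 1 * b 2 * a 3 * b 4 + a 0 * b 1 * a 2 * a 3 * b 4
          + b 0 * a 1 * a 2 * a 3 * b 4 + a 0 * a 1 * b 2 * b 3 * a 4 + a 0 * b 1 * a 2 * b 3 * a 4
          + b 0 * a 1 * a 2 * b 3 * a 4 + a 0 * b 1 * b 2 * a 3 * a 4 + b 0 * a 1 * b 2 * a 3 * a 4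
          + b 0 * b 1 * a 2 * a 3 * a 4)
      - (a 0 * b 1 * b 2 * b 3 * b 4 + b 0 * a 1 * b 2 * b 3 * b 4 + b 0 * b 1 * a 2 * b 3 * b 4
          + b 0 * b 1 * b 2 * a 3 * b 4 + b 0 * b 1 * b 2 * b 3 * a 4) ≤ 4 := by
  rw [alsinaLatorre_M5_eq]
  have := (abs_le.mp (abs_mkVal_le_one a b ha hb)).2
  linarith

/-- **Tightness**: at deterministic `±1` values the polynomial is exactly `±1` (“the various
combinations of `a_j = ±s` and `b_j = ±s` always give `±2^{n−1}sⁿ`”), so the bound `1` is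
attained. [cite: Cabello2002nSpinS, §II (proof of eq. (6))] -/
theorem mkVal_vertex : ∀ {n : ℕ} (a b : Fin n → ℝ), (∀ i, a i = 1 ∨ a i = -1) →
    (∀ i, b i = 1 ∨ b i = -1) → mkVal n a b = 1 ∨ mkVal n a b = -1
  | 0, _, _, _, _ => by simp
  | n + 1, a, b, ha, hb => by
    have iha := mkVal_vertex (Fin.init a) (Fin.init b) (fun i => ha _) (fun i => hb _)
    have ihb := mkVal_vertex (Fin.init b) (Fin.init a) (fun i => hb _) (fun i => ha _)
    rw [mkVal_succ]
    rcases ha (Fin.last n) with h1 | h1 <;> rcases hb (Fin.last n) with h2 | h2 <;>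
      rw [h1, h2] <;> rcases iha with h3 | h3 <;> rcases ihb with h4 | h4 <;> rw [h3, h4] <;>
      norm_num

/-! ## The correlator expansion `𝓑_n = Σ_s c_n(s) · Π_i 𝒪_i^{(s_i)}` -/

/-- The Mermin–Klyshko coefficients: `c_n(s)` is the coefficient in `𝓑_n` of the correlator whose
setting word is `s : Fin n → Bool` (`false` = unprimed `𝒪_i`, `true` = primed `𝒪′_i`);
from (2.6), `c_{n+1}(s, t) = ½ (c_n(s) ± c_n(s̄))` with `+` for `t = 𝒪`, `−` for `t = 𝒪′`, where
`s̄` flips every letter (the coefficients of `𝓑′_n`). [cite: KannoSoda2017, §2.2 eq. (2.6)] -/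
noncomputable def mkCoeff : (n : ℕ) → (Fin n → Bool) → ℝ
  | 0, _ => 1
  | n + 1, s =>
      1 / 2 * (mkCoeff n (Fin.init s) +
        (if s (Fin.last n) then -1 else 1) * mkCoeff n (fun i => !(Fin.init s i)))

/-- The value of the setting word `s` at hidden-variable values: `Π_i (s_i ? b_i : a_i)`.
[cite: KannoSoda2017, §2.2 eq. (2.6)] -/
noncomputable def wordVal (s : Fin n → Bool) (a b : Fin n → ℝ) : ℝ :=
  ∏ i, (if s i then b i else a i)

/-- Letter flip `s ↦ s̄` is an involution of the setting words. [folklore] -/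
private def flipEquiv (n : ℕ) : (Fin n → Bool) ≃ (Fin n → Bool) :=
  Function.Involutive.toPerm (fun s i => !s i) fun s => funext fun i => Bool.not_not (s i)

/-- Flipping every letter exchanges the roles of `a` and `b`. [folklore] -/
private theorem wordVal_flip (s : Fin n → Bool) (a b : Fin n → ℝ) :
    wordVal (fun i => !s i) a b = wordVal s b a := by
  unfold wordVal
  refine Finset.prod_congr rfl fun i _ => ?_
  cases h : s i <;> simp [h]

/-- Splitting a word on `n + 1` letters ending in `𝒪′` into its last letter and its initial
part. [folklore] -/
private theorem wordVal_snoc_true (s : Fin n → Bool) (a b : Fin (n + 1) → ℝ) :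
    wordVal (Fin.snoc s true) a b = wordVal s (Fin.init a) (Fin.init b) * b (Fin.last n) := by
  unfold wordVal
  rw [Fin.prod_univ_castSucc]
  simp only [Fin.snoc_castSucc, Fin.snoc_last, if_true]
  rfl

/-- Splitting a word on `n + 1` letters ending in `𝒪` into its last letter and its initial part.
[folklore] -/
private theorem wordVal_snoc_false (s : Fin n → Bool) (a b : Fin (n + 1) → ℝ) :
    wordVal (Fin.snoc s false) a b = wordVal s (Fin.init a) (Fin.init b) * a (Fin.last n) := by
  unfold wordVal
  rw [Fin.prod_univ_castSucc]
  simp only [Fin.snoc_castSucc, Fin.snoc_last, Bool.false_eq_true, if_false]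
  rfl

/-- `Fin.snocEquiv` appends the letter. [folklore] -/
private theorem snocEquiv_apply' (t : Bool) (s : Fin n → Bool) :
    (Fin.snocEquiv fun _ => Bool) (t, s) = Fin.snoc s t := rfl

/-- The coefficient recursion at a word ending in `𝒪′`. [cite: KannoSoda2017, §2.2 eq. (2.6)] -/
theorem mkCoeff_snoc_true (s : Fin n → Bool) :
    mkCoeff (n + 1) (Fin.snoc s true) = 1 / 2 * (mkCoeff n s - mkCoeff n fun i => !s i) := by
  simp only [mkCoeff, Fin.init_snoc, Fin.snoc_last, if_true]
  ring

/-- The coefficient recursion at a word ending in `𝒪`. [cite: KannoSoda2017, §2.2 eq. (2.6)] -/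
theorem mkCoeff_snoc_false (s : Fin n → Bool) :
    mkCoeff (n + 1) (Fin.snoc s false) = 1 / 2 * (mkCoeff n s + mkCoeff n fun i => !s i) := by
  simp only [mkCoeff, Fin.init_snoc, Fin.snoc_last, Bool.false_eq_true, if_false]
  ring

/-- **Correlator expansion.**  `𝓑_n(a, b) = Σ_{s : Fin n → Bool} c_n(s) · Π_i (s_i ? b_i : a_i)`:
the recursively defined polynomial is the printed linear combination of the `2ⁿ` correlators.
[cite: KannoSoda2017, §2.2 eqs. (2.6)–(2.7); Cabello2002nSpinS, §II (“linear combination of …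
correlations … defined recursively”)] -/
theorem mkVal_eq_sum : ∀ {n : ℕ} (a b : Fin n → ℝ),
    mkVal n a b = ∑ s : Fin n → Bool, mkCoeff n s * wordVal s a b
  | 0, a, b => by
    simp [wordVal, mkCoeff]
  | n + 1, a, b => by
    have iha := mkVal_eq_sum (Fin.init a) (Fin.init b)
    have ihb := mkVal_eq_sum (Fin.init b) (Fin.init a)
    -- the `𝓑′_n` sum, reindexed by the letter flip
    have ihb' : mkVal n (Fin.init b) (Fin.init a) =
        ∑ s : Fin n → Bool, mkCoeff n (fun i => !s i) * wordVal s (Fin.init a) (Fin.init b) := by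
      rw [ihb, ← (flipEquiv n).sum_comp]
      refine Finset.sum_congr rfl fun s _ => ?_
      have hflip : (flipEquiv n s : Fin n → Bool) = fun i => !s i := rfl
      rw [hflip, wordVal_flip]
    -- reindex the words on `n + 1` letters as (last letter, initial word)
    rw [← (Fin.snocEquiv fun _ => Bool).sum_comp, Fintype.sum_prod_type, Fintype.sum_bool]
    simp only [snocEquiv_apply', wordVal_snoc_true, wordVal_snoc_false, mkCoeff_snoc_true,
      mkCoeff_snoc_false]
    rw [mkVal_succ, iha, ihb', Finset.mul_sum, Finset.mul_sum, Finset.sum_mul, Finset.sum_mul,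
      ← Finset.sum_add_distrib, ← Finset.sum_add_distrib]
    refine Finset.sum_congr rfl fun s _ => ?_
    ring

/-- At the response values of an LHV model the word value is the product of responses:
`Π_i (s_i ? X_i(𝒪′) : X_i(𝒪)) = Π_i X_i(s_i)`. [folklore] -/
private theorem wordVal_eq_prod {Λ : Type*} (X : Fin n → Bool → Λ → ℝ) (s : Fin n → Bool)
    (l : Λ) :
    wordVal s (fun i => X i false l) (fun i => X i true l) = ∏ i, X i (s i) l := by
  unfold wordVal
  refine Finset.prod_congr rfl fun i _ => ?_
  cases s i <;> rfl

/-! ## Local hidden-variable models -/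

section LHV

variable {Λ : Type*} [MeasurableSpace Λ] {μ : Measure Λ}

/-- **`|∫ 𝓑_n dμ| ≤ 1`**: for a probability space of hidden variables and `[−1,1]`-valued
responses, the average of the Mermin–Klyshko polynomial is at most `1` in absolute value (no
measurability needed: a non-integrable integrand has integral `0`).
[cite: KannoSoda2017, §2.2 eq. (2.8)] -/
theorem abs_integral_mkVal_le_one [IsProbabilityMeasure μ] (A B : Fin n → Λ → ℝ)
    (hA : ∀ i l, |A i l| ≤ 1) (hB : ∀ i l, |B i l| ≤ 1) :
    |∫ l, mkVal n (fun i => A i l) (fun i => B i l) ∂μ| ≤ 1 := by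
  have hpt : ∀ l, |mkVal n (fun i => A i l) (fun i => B i l)| ≤ 1 :=
    fun l => abs_mkVal_le_one _ _ (fun i => hA i l) (fun i => hB i l)
  by_cases hf : Integrable (fun l => mkVal n (fun i => A i l) (fun i => B i l)) μ
  · calc |∫ l, mkVal n (fun i => A i l) (fun i => B i l) ∂μ|
        ≤ ∫ l, |mkVal n (fun i => A i l) (fun i => B i l)| ∂μ := abs_integral_le_integral_abs
      _ ≤ ∫ _l, (1 : ℝ) ∂μ := integral_mono hf.abs (integrable_const _) hpt
      _ = 1 := by rw [integral_const, smul_eq_mul, probReal_univ, one_mul]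
  · rw [integral_undef hf, abs_zero]; exact zero_le_one

/-- A product of `[−1,1]`-valued a.e.-strongly-measurable responses is integrable. [folklore] -/
private theorem integrable_prod [IsFiniteMeasure μ] (X : Fin n → Bool → Λ → ℝ)
    (hm : ∀ i t, AEStronglyMeasurable (X i t) μ) (hb : ∀ i t l, |X i t l| ≤ 1)
    (s : Fin n → Bool) : Integrable (fun l => ∏ i, X i (s i) l) μ := by
  refine Integrable.of_bound (Finset.aestronglyMeasurable_fun_prod _ fun i _ => hm i (s i)) 1
    (ae_of_all _ fun l => ?_)
  rw [Real.norm_eq_abs, Finset.abs_prod]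
  exact Finset.prod_le_one (fun i _ => abs_nonneg _) fun i _ => hb i (s i) l

/-- **The Mermin–Klyshko inequality.**  For every local hidden-variable model — a probability
space `(Λ, μ)` and, for each party `i < n` and setting `t ∈ {𝒪, 𝒪′}`, a `[−1,1]`-valued
a.e.-strongly-measurable response `X i t` — the Mermin–Klyshko combination of the `2ⁿ`
correlators `E(s) = ∫ Π_i X_i(s_i) dμ` satisfies `|⟨𝓑_n⟩| = |Σ_s c_n(s) E(s)| ≤ 1`.
[cite: KannoSoda2017, §2.2 eq. (2.8)] -/
theorem mermin_klyshko_inequality [IsProbabilityMeasure μ] (X : Fin n → Bool → Λ → ℝ)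
    (hm : ∀ i t, AEStronglyMeasurable (X i t) μ) (hb : ∀ i t l, |X i t l| ≤ 1) :
    |∑ s : Fin n → Bool, mkCoeff n s * ∫ l, ∏ i, X i (s i) l ∂μ| ≤ 1 := by
  have hint := integrable_prod X hm hb
  have e : ∑ s : Fin n → Bool, mkCoeff n s * ∫ l, ∏ i, X i (s i) l ∂μ =
      ∫ l, mkVal n (fun i => X i false l) (fun i => X i true l) ∂μ := by
    simp_rw [mkVal_eq_sum, wordVal_eq_prod]
    rw [integral_finsetSum _ fun s _ => (hint s).const_mul _]
    refine Finset.sum_congr rfl fun s _ => ?_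
    rw [integral_const_mul]
  rw [e]
  exact abs_integral_mkVal_le_one _ _ (fun i l => hb i false l) (fun i l => hb i true l)

/-- **Cabello's form** (`s = 1`): `|⟨M_n⟩| = |Σ_s 2^{n−1}c_n(s) E(s)| ≤ 2^{n−1}`.
[cite: Cabello2002nSpinS, §II eq. (6)] -/
theorem mermin_klyshko_inequality_cabello [IsProbabilityMeasure μ] (X : Fin n → Bool → Λ → ℝ)
    (hm : ∀ i t, AEStronglyMeasurable (X i t) μ) (hb : ∀ i t l, |X i t l| ≤ 1) :
    |∑ s : Fin n → Bool, 2 ^ (n - 1) * mkCoeff n s * ∫ l, ∏ i, X i (s i) l ∂μ| ≤ 2 ^ (n - 1) := by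
  have h := mermin_klyshko_inequality X hm hb
  simp_rw [mul_assoc, ← Finset.mul_sum, abs_mul, abs_of_pos (by positivity : (0:ℝ) < 2 ^ (n - 1))]
  calc (2:ℝ) ^ (n - 1) * |∑ s : Fin n → Bool, mkCoeff n s * ∫ l, ∏ i, X i (s i) l ∂μ|
      ≤ 2 ^ (n - 1) * 1 := by gcongr
    _ = 2 ^ (n - 1) := mul_one _

/-- The case `n = 2` is the CHSH inequality of `CHSHInequality.lean` (up to the factor `2`):
`|E(A,B) + E(A,B′) + E(A′,B) − E(A′,B′)| ≤ 2` in the `lhvCorr` vocabulary.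
[cite: Cabello2002nSpinS, §II (“If n = 2 we obtain the CHSH inequality”)] -/
theorem chsh_of_mermin_klyshko [IsProbabilityMeasure μ] {A A' B B' : Λ → ℝ}
    (hA : ∀ l, |A l| ≤ 1) (hA' : ∀ l, |A' l| ≤ 1) (hB : ∀ l, |B l| ≤ 1) (hB' : ∀ l, |B' l| ≤ 1)
    (mA : AEStronglyMeasurable A μ) (mA' : AEStronglyMeasurable A' μ)
    (mB : AEStronglyMeasurable B μ) (mB' : AEStronglyMeasurable B' μ) :
    |LHV.lhvCorr μ A B + LHV.lhvCorr μ A B' + LHV.lhvCorr μ A' B - LHV.lhvCorr μ A' B'| ≤ 2 := by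
  have i1 := LHV.integrable_mul_of_abs_le_one mA mB hA hB
  have i2 := LHV.integrable_mul_of_abs_le_one mA mB' hA hB'
  have i3 := LHV.integrable_mul_of_abs_le_one mA' mB hA' hB
  have i4 := LHV.integrable_mul_of_abs_le_one mA' mB' hA' hB'
  have e : LHV.lhvCorr μ A B + LHV.lhvCorr μ A B' + LHV.lhvCorr μ A' B - LHV.lhvCorr μ A' B' =
      2 * ∫ l, mkVal 2 (fun i => ![A, B] i l) (fun i => ![A', B'] i l) ∂μ := by
    have h2 : ∀ l, mkVal 2 (fun i => ![A, B] i l) (fun i => ![A', B'] i l) =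
        1 / 2 * (A l * B l + A l * B' l + A' l * B l - A' l * B' l) := by
      intro l; rw [mkVal_two]; simp only [Matrix.cons_val_zero, Matrix.cons_val_one]
    have i12 : Integrable (fun l => A l * B l + A l * B' l) μ := i1.add i2
    have i123 : Integrable (fun l => A l * B l + A l * B' l + A' l * B l) μ := i12.add i3
    simp_rw [h2, LHV.lhvCorr]
    rw [integral_const_mul, integral_sub i123 i4, integral_add i12 i3, integral_add i1 i2]
    ring
  rw [e, abs_mul, abs_two]
  have h := abs_integral_mkVal_le_one (μ := μ) (fun i => ![A, B] i) (fun i => ![A', B'] i)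
    (fun i l => by fin_cases i <;> simp [hA l, hB l]) (fun i l => by fin_cases i <;> simp [hA' l, hB' l])
  linarith

end LHV

end MerminKlyshko

end Literature.InformationTheory.Entanglement
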